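import Summits.QuantumFields.BalabanUV.T4Continuum.Support.NE7EtaClosenessWeak
import Summits.QuantumFields.BalabanUV.T4Continuum.Support.NE7SocketHOfPointwiseLetters
import HarnessLib

/-!
# NE7EtaWeakSocketBridges — route #1 of the NE7 crux (node U5), socket `h` AMENDMENT 6 (ROAD-G107 §3): THE WEAK SOCKET `h_w` IS THE WEAKEST —
# (i) a supplier needs only (E) + (Gᶜ_w) (the (Lip₁ᶜ) conjunct follows with `Λ₁ := Λ_G`, since `θ^{38k} ≤ ξ² = θ^{36k}`);
# (ii) the pointwise socket `hpt` of gen 106 (`NE7SocketHOfPointwiseLetters`) implies `h_w` (`p₁ξ³ = p₁θ^{54k} ≤ p₁θ^{38k}`)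

Cell `pub-balaban`, rung (B)+1 sub-cell t4, lineage `b2b-balaban-t4-ne7-p1`, generation 107 (CRUX PROVER NE7 #1 = OWNER of BINDER row NE7).
Memo `t4/b2b-balaban-t4-ne7-p1-g107/ROAD-G107.md` §3.
WHAT ([folklore]; 0 def, 0 sorry; base `θ^{18} = L⁻¹`).  §1 `pow38_le_scale_sq` (`θ^{38k} ≤ ((L⁻¹)^k)²`), `scale_cube_le_pow38` (`((L⁻¹)^k)³ ≤ θ^{38k}`);
§2 **`covRootW_of_energy_gradRate`** — for any class: representation ∧ (E) ∧ (Gᶜ_w) at every level ⟹ `h_w` (with `Λ₁ := Λ_G`); §3 **`covRootW_of_pointwise`** — `hpt` ⟹ `h_w`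
(`∃ C Λ₁ Λ_G ≥ 0`; `L = 2`; (E) and (Lip₁ᶜ) exactly as in gen 106's `socketH_of_pointwise`, for the SAME pair).
HONEST FRAMING (page 1): bookkeeping over landed kernel theorems; every socket is a HYPOTHESIS, asserted for no class; nothing of NE3∕NE7 discharged; nothing of
Bałaban's asserted as an axiom; spine count = dagwriter∕referees' call; FIXED FINITE T⁴, rung (B)+1 — NOT infinite volume, NOT mass gap, NOT BetaPertH, NOT Clay.
-/

set_option autoImplicit false

open scoped BigOperators Matrix Matrix.Norms.L2Operator
open Finset

namespace Summit.QuantumFields.BalabanUV.T4Continuum.NE7EtaWeakSocketBridges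

open Literature.MathematicalPhysics.QuantumFieldTheory.Balaban1983to89
open B7Prop1Explicit B7Prop2Explicit
open T4AveragingDeficitWall hiding Site Plane Plaq Bond
open T4AveragingDeficitWallBoundary (periodBox IsPeriodicCfg)
open AveragingDeficitPeriodicCounting (IsPeriodicDir)
open MinimalActionSandwich (IsMinimiser)
open MinimalActionRate (Regular)
open NE3EnergyShapes (residualScale IsUnitarySite IsPeriodicSite)
open NE3EnergyWeightedShapes (energyNormW)
open NE7EtaRatesD4Holder (scale18_eq theta_le_one)
open AveragingDeficitDualResidual (dualC2)
open AveragingDeficitDerivWallProof (wallConst)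
open NE7EtaRatesD4CovReg (unitary_periodic_rescale_bavg_of_regular)
open NE7EnergyRateWPrep (residualScale_lower_d4 wallConst_pos dualC2_pos_d4)
open NE7SocketHOfPointwiseLetters (energyNormW_le_of_pointwise_d4)

noncomputable section

variable {n : Type*} [Fintype n] [DecidableEq n]

/-! ## §1 The two exponent comparisons at base `θ^{18} = L⁻¹` -/

/-- `θ^{38k} ≤ ξ² = ((L⁻¹)^k)²` (`= θ^{36k}`; `0 < θ ≤ 1`). [folklore] -/
theorem pow38_le_scale_sq {L : ℕ} (hL : 2 ≤ L) {θ : ℝ} (hθ : 0 < θ) (hθ18 : θ ^ 18 = ((L : ℝ))⁻¹) (k : ℕ) :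
    θ ^ (38 * k) ≤ (((L : ℝ)⁻¹) ^ k) ^ 2 := by
  have hL1 : 1 ≤ L := by omega
  obtain ⟨hξ, -⟩ := scale18_eq hL1 hθ hθ18 k
  have hθ1 : θ ≤ 1 := theta_le_one hL hθ hθ18
  rw [hξ, ← pow_mul, show 18 * k * 2 = 36 * k by ring]
  exact pow_le_pow_of_le_one hθ.le hθ1 (by omega)

/-- `ξ³ = ((L⁻¹)^k)³ ≤ θ^{38k}` (`= θ^{54k} ≤ θ^{38k}`; `0 < θ ≤ 1`). [folklore] -/
theorem scale_cube_le_pow38 {L : ℕ} (hL : 2 ≤ L) {θ : ℝ} (hθ : 0 < θ) (hθ18 : θ ^ 18 = ((L : ℝ))⁻¹) (k : ℕ) :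
    (((L : ℝ)⁻¹) ^ k) ^ 3 ≤ θ ^ (38 * k) := by
  have hL1 : 1 ≤ L := by omega
  obtain ⟨hξ, -⟩ := scale18_eq hL1 hθ hθ18 k
  have hθ1 : θ ≤ 1 := theta_le_one hL hθ hθ18
  rw [hξ, ← pow_mul, show 18 * k * 3 = 54 * k by ring]
  exact pow_le_pow_of_le_one hθ.le hθ1 (by omega)

/-! ## §2 A supplier needs only (E) + (Gᶜ_w) -/

/-- **`h_w` FROM (E) + (Gᶜ_w)** (any dimension `d`, any class `𝒞`; `L ≥ 2`, `θ^{18} = L⁻¹`): if every minimiser pair has a representation with the energy rate (E) and the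
covariant-gradient RATE (Gᶜ_w) `‖Ad (W (x+e κ) μ) (Z (x+e μ) κ) − Z x κ‖ ≤ Λ_G·θ^{38k}`, then the weak socket `h_w` = (E) ∧ (Lip₁ᶜ) ∧ (Gᶜ_w) holds with `Λ₁ := Λ_G`
(`Λ_G ≥ 0`; `θ^{38k} ≤ ξ²`). [folklore] -/
theorem covRootW_of_energy_gradRate {d : ℕ} {𝒞 : ℕ → Set (Site d → Fin d → (Matrix n n ℂ)ˣ)} {L N : ℕ} (hL : 2 ≤ L) {θ : ℝ} (hθ : 0 < θ)
    (hθ18 : θ ^ 18 = ((L : ℝ))⁻¹) {b g C ΛG : ℝ} (hΛG : 0 ≤ ΛG) {dom : Set (Site d → Fin d → (Matrix n n ℂ)ˣ)}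
    (h : ∀ k : ℕ, 1 ≤ k → ∀ V ∈ dom, ∀ UA UB : Site d → Fin d → (Matrix n n ℂ)ˣ,
      IsMinimiser d 𝒞 L N k V UA → IsMinimiser d 𝒞 L N (k + 1) V UB → Regular d L N b g (k + 1) UB →
        ∃ (u : Site d → (Matrix n n ℂ)ˣ) (Z : Site d → Fin d → Matrix n n ℂ),
          IsUnitarySite u ∧ IsPeriodicSite u ((N * L ^ k : ℕ) : ℤ) ∧
          IsSkewDir Z ∧ IsPeriodicDir Z ((N * L ^ k : ℕ) : ℤ) ∧
          gaugeAct u UA = vary (rescale L (bavg L UB)) Z 1 ∧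
          energyNormW L k (rescale L (bavg L UB)) Z (periodBox (N * L ^ k)) ≤ C * residualScale d L N b g k ∧
          (∀ (κ : Fin d) (x : Site d) (μ : Fin d),
            ‖Ad (rescale L (bavg L UB) (x + e κ) μ) (Z (x + e μ) κ) - Z x κ‖ ≤ ΛG * θ ^ (38 * k))) :
    ∀ k : ℕ, 1 ≤ k → ∀ V ∈ dom, ∀ UA UB : Site d → Fin d → (Matrix n n ℂ)ˣ,
      IsMinimiser d 𝒞 L N k V UA → IsMinimiser d 𝒞 L N (k + 1) V UB → Regular d L N b g (k + 1) UB →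
        ∃ (u : Site d → (Matrix n n ℂ)ˣ) (Z : Site d → Fin d → Matrix n n ℂ),
          IsUnitarySite u ∧ IsPeriodicSite u ((N * L ^ k : ℕ) : ℤ) ∧
          IsSkewDir Z ∧ IsPeriodicDir Z ((N * L ^ k : ℕ) : ℤ) ∧
          gaugeAct u UA = vary (rescale L (bavg L UB)) Z 1 ∧
          energyNormW L k (rescale L (bavg L UB)) Z (periodBox (N * L ^ k)) ≤ C * residualScale d L N b g k ∧
          (∀ (κ : Fin d) (x : Site d) (μ : Fin d),
            ‖Ad (rescale L (bavg L UB) (x + e κ) μ) (Z (x + e μ) κ) - Z x κ‖ ≤ ΛG * (((L : ℝ)⁻¹) ^ k) ^ 2) ∧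
          (∀ (κ : Fin d) (x : Site d) (μ : Fin d),
            ‖Ad (rescale L (bavg L UB) (x + e κ) μ) (Z (x + e μ) κ) - Z x κ‖ ≤ ΛG * θ ^ (38 * k)) := by
  intro k hk V hV UA UB hA hB hreg
  obtain ⟨u, Z, hu, huP, hZ, hZP, hrep, hE, hG⟩ := h k hk V hV UA UB hA hB hreg
  refine ⟨u, Z, hu, huP, hZ, hZP, hrep, hE, fun κ x μ => (hG κ x μ).trans ?_, hG⟩
  exact mul_le_mul_of_nonneg_left (pow38_le_scale_sq hL hθ hθ18 k) hΛG

/-! ## §3 The pointwise socket implies the weak socket -/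

/-- **`hpt` ⟹ `h_w`** (`L = 2`, `θ^{18} = 2⁻¹`, class data `0 ≤ b`, `512·5·8·L²·b ≤ 1`, `0 < g`, `0 ≤ p₁`): the pointwise letters (P0) `‖Z‖ ≤ p₀ξ²`,
(P1) `‖∇_W Z‖ ≤ p₁ξ³` of gen 106's socket give `h_w` with `C = 2√(4·#Plane·p₁² + 4p₀²)∕(wallConst·dualC2·√g)` (gen 106), `Λ₁ = p₁`, `Λ_G = p₁`. [folklore] -/
theorem covRootW_of_pointwise [Nonempty n] {𝒞 : ℕ → Set (Site 4 → Fin 4 → (Matrix n n ℂ)ˣ)} {L N : ℕ} (hL : L = 2) {θ : ℝ} (hθ : 0 < θ)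
    (hθ18 : θ ^ 18 = ((L : ℝ))⁻¹) {b g p₀ p₁ : ℝ} (hb : 0 ≤ b) (hbs : 512 * (4 + 1) * (4 + 4) * (L : ℝ) ^ 2 * b ≤ 1) (hg : 0 < g) (hp₁ : 0 ≤ p₁)
    {dom : Set (Site 4 → Fin 4 → (Matrix n n ℂ)ˣ)}
    (hP : ∀ k : ℕ, 1 ≤ k → ∀ V ∈ dom, ∀ UA UB : Site 4 → Fin 4 → (Matrix n n ℂ)ˣ,
      IsMinimiser 4 𝒞 L N k V UA → IsMinimiser 4 𝒞 L N (k + 1) V UB → Regular 4 L N b g (k + 1) UB →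
        ∃ (u : Site 4 → (Matrix n n ℂ)ˣ) (Z : Site 4 → Fin 4 → Matrix n n ℂ),
          IsUnitarySite u ∧ IsPeriodicSite u ((N * L ^ k : ℕ) : ℤ) ∧ IsSkewDir Z ∧ IsPeriodicDir Z ((N * L ^ k : ℕ) : ℤ) ∧
          gaugeAct u UA = vary (rescale L (bavg L UB)) Z 1 ∧
          (∀ (x : Site 4) (κ : Fin 4), ‖Z x κ‖ ≤ p₀ * (((L : ℝ)⁻¹) ^ k) ^ 2) ∧
          (∀ (κ : Fin 4) (x : Site 4) (μ : Fin 4),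
            ‖Ad (rescale L (bavg L UB) (x + e κ) μ) (Z (x + e μ) κ) - Z x κ‖ ≤ p₁ * (((L : ℝ)⁻¹) ^ k) ^ 3)) :
    ∃ C Λ₁ ΛG : ℝ, 0 ≤ C ∧ 0 ≤ Λ₁ ∧ 0 ≤ ΛG ∧
      ∀ k : ℕ, 1 ≤ k → ∀ V ∈ dom, ∀ UA UB : Site 4 → Fin 4 → (Matrix n n ℂ)ˣ,
        IsMinimiser 4 𝒞 L N k V UA → IsMinimiser 4 𝒞 L N (k + 1) V UB → Regular 4 L N b g (k + 1) UB →
          ∃ (u : Site 4 → (Matrix n n ℂ)ˣ) (Z : Site 4 → Fin 4 → Matrix n n ℂ),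
            IsUnitarySite u ∧ IsPeriodicSite u ((N * L ^ k : ℕ) : ℤ) ∧
            IsSkewDir Z ∧ IsPeriodicDir Z ((N * L ^ k : ℕ) : ℤ) ∧
            gaugeAct u UA = vary (rescale L (bavg L UB)) Z 1 ∧
            energyNormW L k (rescale L (bavg L UB)) Z (periodBox (N * L ^ k)) ≤ C * residualScale 4 L N b g k ∧
            (∀ (κ : Fin 4) (x : Site 4) (μ : Fin 4),
              ‖Ad (rescale L (bavg L UB) (x + e κ) μ) (Z (x + e μ) κ) - Z x κ‖ ≤ Λ₁ * (((L : ℝ)⁻¹) ^ k) ^ 2) ∧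
            (∀ (κ : Fin 4) (x : Site 4) (μ : Fin 4),
              ‖Ad (rescale L (bavg L UB) (x + e κ) μ) (Z (x + e μ) κ) - Z x κ‖ ≤ ΛG * θ ^ (38 * k)) := by
  subst hL
  -- the constants of gen 106's `socketH_of_pointwise`
  set cP : ℝ := (Fintype.card (T4AveragingDeficitWall.Plane 4) : ℝ) with hcP_def
  set A : ℝ := Real.sqrt (4 * cP * p₁ ^ 2 + 4 * p₀ ^ 2) with hA_def
  set w : ℝ := wallConst 4 2 * dualC2 4 2 * Real.sqrt g with hw_def
  have hw0 : 0 < w := by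
    rw [hw_def]; exact mul_pos (mul_pos (wallConst_pos 4 2) dualC2_pos_d4) (Real.sqrt_pos.2 hg)
  have hA0 : 0 ≤ A := Real.sqrt_nonneg _
  have hL2 : 2 ≤ (2 : ℕ) := le_rfl
  refine ⟨2 * A / w, p₁, p₁, by positivity, hp₁, hp₁, ?_⟩
  intro k hk V hV UA UB hA hB hreg
  obtain ⟨u, Z, hu, huP, hZs, hZP, hgauge, hP0, hP1⟩ := hP k hk V hV UA UB hA hB hreg
  have hWu : IsUnitaryCfg (rescale 2 (bavg 2 UB)) :=
    (unitary_periodic_rescale_bavg_of_regular (by norm_num) hb hbs hreg).1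
  refine ⟨u, Z, hu, huP, hZs, hZP, hgauge, ?_, ?_, ?_⟩
  · -- (E) from (P0)(P1), as in gen 106
    have hE := energyNormW_le_of_pointwise_d4 (L := 2) (by norm_num) N k hWu hP0 hP1
    obtain ⟨j, rfl⟩ : ∃ j, k = j + 1 := ⟨k - 1, by omega⟩
    have hlow := residualScale_lower_d4 N j (b := b) hg.le
    have hs : (((2 : ℕ) : ℝ)⁻¹) ^ (j + 1) = (((2 : ℕ) : ℝ) ^ (j + 1))⁻¹ := inv_pow _ _
    have hid : A * (N : ℝ) ^ 2 * (((2 : ℕ) : ℝ)⁻¹) ^ (j + 1)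
        = 2 * A / w * (wallConst 4 2 * dualC2 4 2 * Real.sqrt g * (N : ℝ) ^ 2 / (2 * ((2 : ℕ) : ℝ) ^ (j + 1))) := by
      rw [hs, ← hw_def]; field_simp
    calc energyNormW 2 (j + 1) (rescale 2 (bavg 2 UB)) Z (periodBox (N * 2 ^ (j + 1)))
        ≤ A * (N : ℝ) ^ 2 * (((2 : ℕ) : ℝ)⁻¹) ^ (j + 1) := hE
      _ = 2 * A / w * (wallConst 4 2 * dualC2 4 2 * Real.sqrt g * (N : ℝ) ^ 2 / (2 * ((2 : ℕ) : ℝ) ^ (j + 1))) := hid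
      _ ≤ 2 * A / w * residualScale 4 2 N b g (j + 1) := mul_le_mul_of_nonneg_left hlow (by positivity)
  · -- (Lip₁ᶜ) from (P1): `ξ³ ≤ ξ²`
    intro κ x μ
    have hs0 : 0 ≤ (((2 : ℕ) : ℝ)⁻¹) ^ k := by positivity
    have hs1 : (((2 : ℕ) : ℝ)⁻¹) ^ k ≤ 1 := pow_le_one₀ (by positivity) (by norm_num)
    have h3 : ((((2 : ℕ) : ℝ)⁻¹) ^ k) ^ 3 ≤ ((((2 : ℕ) : ℝ)⁻¹) ^ k) ^ 2 := by
      rw [pow_succ]; exact mul_le_of_le_one_right (by positivity) hs1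
    exact (hP1 κ x μ).trans (mul_le_mul_of_nonneg_left h3 hp₁)
  · -- (Gᶜ_w) from (P1): `ξ³ = θ^{54k} ≤ θ^{38k}`
    exact fun κ x μ => (hP1 κ x μ).trans (mul_le_mul_of_nonneg_left (scale_cube_le_pow38 hL2 hθ hθ18 k) hp₁)

end

end Summit.QuantumFields.BalabanUV.T4Continuum.NE7EtaWeakSocketBridges
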